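import Summits.CriticalPhenomena.SAWScalingLimit.Theorems.SAWWeldingIdentificationWeldingLawOfLimitMarginals
import Summits.CriticalPhenomena.SAWScalingLimit.Theorems.SAWWeldingIdentificationRemovableLimitIdle

/-!
# The welding law along chord-supported approximants (crux `WeldingLawOfLimit`, stmt-4502, skeleton v3)

Route `SAWWeldingIdentification` of `CriticalPhenomena/SAWScalingLimit`, crux (W)
`WeldingLawOfLimit` (stmt-CriticalPhenomena-4502), line `registered`. Lead c3 reshaped the held
stub `CanonicalWeldingLaw` (the canonical-welding finite-dimensional laws of every chord-supported
subsequential limit `P` of the critical `ℤ²` SAW laws are those of chordal SLE_{8/3}) into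

* (2a) `ApproxWeldingLaw` — for every chord-supported subsequential limit `P` there are
  chord-supported probability measures `Pₙ → P` (weakly) whose canonical-welding marginals converge
  weakly to those of SLE_{8/3} (intended witnesses: laws of chord-completed lattice walks — "the
  lattice welding laws converge to the SLE_{8/3} welding law", where the route's engine, bank
  independence + Sheffield's quantum zipper, would act); research-open, held;
* (2b) `WeldingMarginalsOfLimit` — welding marginals pass to chord-supported weak limits along
  chord-supported approximants; PROVED (`weldingMarginalsOfLimit`, file
  `…WeldingLawOfLimitMarginals.lean`, continuous mapping on the carrying Borel set of simple chords).

This support file records, sorry-free and with the statements inlined as hypotheses: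

* `canonicalWeldingLaw_of_approxWeldingLaw`: (2a) ⇒ `CanonicalWeldingLaw` (via the proved (2b):
  two weak limits of one sequence of image laws on `ℝᵏ` coincide);
* `approxWeldingLaw_of_weldingLawOfLimit`: the crux ⇒ (2a) (constant approximants), so with the
  tree's reductions (2a) ∧ stmt-4982 ⟺ (W) ⟺ stmt-0783 — the reshape adds and hides no strength;
* `weldingLawOfLimit_of_simpleSubseqLimits_of_approxWeldingLaw`,
  `subseqIdentification_of_simpleSubseqLimits_of_approxWeldingLaw`,
  `sawScalingLimit_of_simpleSubseqLimits_of_approxWeldingLaw_of_eventualTight`: the skeleton's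
  composition and what remains of the route, at item level (stmt-4982 ∧ (2a) [∧ stmt-1372]);
* `eq_map_of_chordSupport_of_forall_rat_marginals_eq` (and its real-point / `IsSLELaw` forms):
  **a chord-supported probability measure on curve space whose canonical-welding marginals at
  positive RATIONAL points are those of chordal SLE_{8/3} IS the SLE_{8/3} law** — the route's
  mechanism (one-sided welding rigidity of removable chords + identification by disintegration,
  `RemovableLimit.identifyFromWelding_oneSided`) as one unconditional per-measure theorem over the
  Literature functional `conformalWelding`, for use by any line of the shared identification crux
  stmt-0783 that controls welding marginals.

No new definition, no named fact; every ingredient is a proved tree theorem.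

References: Billingsley (1999) §2; Sheffield, Ann. Probab. 44 (2016) §1.4; Jones–Smirnov, Ark.
Mat. 38 (2000); Rohde–Schramm, Ann. Math. 161 (2005) Thms 5.2, 6.1; Pommerenke (1992) Thm 2.11.
-/

noncomputable section

open MeasureTheory Filter Topology Set
open Literature.Probability.RandomPlanarGeometry Literature.Probability.LatticeModels
open Literature.Probability.Process (preWienerMeasure)
open UpperHalfPlane (upperHalfPlaneSet)
open Summit.CriticalPhenomena.SAWScalingLimit.Theses

namespace Summit.CriticalPhenomena.SAWScalingLimit.Theorems.WeldingLawOfLimit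

/-! ### The welding vector -/

/-- The welding vector `γ ↦ (conformalWelding Q γ xᵢ)ᵢ` is Borel (`measurable_conformalWelding`).
[folklore] -/
theorem measurable_weldingVector (Q : ConformalRectangle) {k : ℕ} (x : Fin k → ℝ) :
    Measurable fun (γ : CurveClass ℂ) (i : Fin k) => conformalWelding Q γ (x i) :=
  measurable_pi_lambda _ fun i => measurable_conformalWelding Q (x i)

/-! ### Identification of a chord-supported law by its canonical welding marginals -/

/-- **A chord-supported law with the SLE_{8/3} canonical-welding marginals is the SLE_{8/3} law.**
Let `Q` be a conformal rectangle, `P` a probability measure on `CurveClass ℂ` carried by the simple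
chords of `(Ω; a, b) = Q.chord 0 2`, and `Γ` a chordal SLE_{8/3} random curve in `(Ω; a, b)`. If
for every `k` and all positive rationals `x₁, …, x_k` the law of
`(conformalWelding Q γ x₁, …, conformalWelding Q γ x_k)` under `P` equals that under `ℙ ∘ Γ⁻¹`,
then `P = ℙ ∘ Γ⁻¹`. Proof: the one-sided identification `identifyFromWelding_oneSided`
(disintegration over the welding vector) for `W := conformalWelding` (Borel:
`measurable_conformalWelding`; pinned: `weldingSetup_partII`), with `R :=` "removable simple chord"
carried by the SLE law (`SLERemovableChord_proof`, Rohde–Schramm Thms 5.2/6.1 + Jones–Smirnov) and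
ONE-SIDED welding rigidity (`weldingRigidity_proof`: a removable simple chord and any simple chord
with the same welding on `ℚ₊` coincide; configurations from `WeldingSetup_proof`). Sheffield (2016)
§1.4. [folklore] -/
theorem eq_map_of_chordSupport_of_forall_rat_marginals_eq (Q : ConformalRectangle)
    (P : Measure (CurveClass ℂ)) [IsProbabilityMeasure P]
    (hP : ∀ᵐ γ ∂P, (Q.chord 0 2 (by decide)).IsSimpleChord γ)
    {Γ : (NNReal → ℝ) → CurveClass ℂ} (hΓ : IsSLECurve ((8 : NNReal) / 3) (Q.chord 0 2 (by decide)) Γ)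
    (hmarg : ∀ (k : ℕ) (x : Fin k → ℚ), (∀ i, 0 < x i) →
      P.map (fun γ i => conformalWelding Q γ (x i)) =
        (preWienerMeasure.map Γ).map (fun γ i => conformalWelding Q γ (x i))) :
    P = preWienerMeasure.map Γ := by
  -- adapted from `RemovableLimit.isSLELaw_of_weldingLawOfLimit`
  -- (Theorems/SAWWeldingIdentificationRemovableLimitIdle.lean), for the canonical functional
  haveI : IsProbabilityMeasure preWienerMeasure :=
    Literature.Probability.RandomPlanarGeometry.isProbabilityMeasure_preWienerMeasure'
  have hΓm : AEMeasurable Γ preWienerMeasure := hΓ.1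
  obtain ⟨hsign, -⟩ := WeldingSetup_proof
  obtain ⟨s, hs, hconf⟩ := hsign Q
  refine RemovableLimit.identifyFromWelding_oneSided Q conformalWelding P preWienerMeasure Γ hΓm
    (measurable_conformalWelding Q) hP
    (fun γ => (γ ∈ CurveClass.simple ∧ γ.source = Q.pt 0 ∧ γ.target = Q.pt 2 ∧
        γ.range ⊆ closure Q.carrier ∧ γ.range ∩ frontier Q.carrier ⊆ {Q.pt 0, Q.pt 2}) ∧
      (∀ F : ℂ → ℂ, ContinuousOn F Q.carrier → Set.InjOn F Q.carrier → F '' Q.carrier = Q.carrier →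
        DifferentiableOn ℂ F (Q.carrier \ γ.range) → DifferentiableOn ℂ F Q.carrier))
    (SLERemovableChord_proof Q Γ hΓ) (fun γ hγ => hγ.1) ?_ hmarg
  -- ONE-SIDED rigidity: a removable simple chord and ANY simple chord with the same welding agree
  intro γ γ' hγ hγ' heq
  obtain ⟨L, R, φ, ψ, hb, hn⟩ := hconf γ hγ.1
  obtain ⟨L', R', φ', ψ', hb', hn'⟩ := hconf γ' hγ'
  refine WeldingRigidity.weldingRigidity_proof Q γ γ' s L R L' R' φ ψ φ' ψ'
    (fun q => conformalWelding Q γ q) hγ.1 hγ' hγ.2 hs hb hb' hn hn' ?_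
  intro q hq
  have hq' : (0 : ℝ) < (q : ℝ) := by exact_mod_cast hq
  obtain ⟨hpos₁, hw₁⟩ := weldingSetup_partII Q γ s L R φ ψ hγ.1 hs hb hn q hq'
  obtain ⟨-, hw₂⟩ := weldingSetup_partII Q γ' s L' R' φ' ψ' hγ' hs hb' hn' q hq'
  refine ⟨hpos₁, hw₁, ?_⟩
  rw [heq q hq]
  exact hw₂

/-- Real-point form of `eq_map_of_chordSupport_of_forall_rat_marginals_eq`: equality of the
canonical-welding marginals at all positive REAL points (the shape delivered by
`CanonicalWeldingLaw` / the crux) identifies a chord-supported law with the SLE_{8/3} law.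
[folklore] -/
theorem eq_map_of_chordSupport_of_forall_marginals_eq (Q : ConformalRectangle)
    (P : Measure (CurveClass ℂ)) [IsProbabilityMeasure P]
    (hP : ∀ᵐ γ ∂P, (Q.chord 0 2 (by decide)).IsSimpleChord γ)
    {Γ : (NNReal → ℝ) → CurveClass ℂ} (hΓ : IsSLECurve ((8 : NNReal) / 3) (Q.chord 0 2 (by decide)) Γ)
    (hmarg : ∀ (k : ℕ) (x : Fin k → ℝ), (∀ i, 0 < x i) →
      P.map (fun γ i => conformalWelding Q γ (x i)) =
        (preWienerMeasure.map Γ).map (fun γ i => conformalWelding Q γ (x i))) :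
    P = preWienerMeasure.map Γ :=
  eq_map_of_chordSupport_of_forall_rat_marginals_eq Q P hP hΓ fun k x hx =>
    hmarg k (fun i => (x i : ℝ)) fun i => by exact_mod_cast hx i

/-- `IsSLELaw` form: a chord-supported probability measure with the canonical-welding marginals
(at positive rationals) of SOME chordal SLE_{8/3} curve in `(Ω; a, b)` is a chordal SLE_{8/3} law
in `(Ω; a, b)`. [folklore] -/
theorem isSLELaw_of_chordSupport_of_forall_rat_marginals_eq (Q : ConformalRectangle)
    (P : Measure (CurveClass ℂ)) [IsProbabilityMeasure P]
    (hP : ∀ᵐ γ ∂P, (Q.chord 0 2 (by decide)).IsSimpleChord γ)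
    {Γ : (NNReal → ℝ) → CurveClass ℂ} (hΓ : IsSLECurve ((8 : NNReal) / 3) (Q.chord 0 2 (by decide)) Γ)
    (hmarg : ∀ (k : ℕ) (x : Fin k → ℚ), (∀ i, 0 < x i) →
      P.map (fun γ i => conformalWelding Q γ (x i)) =
        (preWienerMeasure.map Γ).map (fun γ i => conformalWelding Q γ (x i))) :
    IsSLELaw ((8 : NNReal) / 3) (Q.chord 0 2 (by decide)) P :=
  ⟨Γ, hΓ, eq_map_of_chordSupport_of_forall_rat_marginals_eq Q P hP hΓ hmarg⟩

/-! ### Stub 2a ⇒ `CanonicalWeldingLaw` (through the proved stub 2b) -/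

/-- **`ApproxWeldingLaw ⇒ CanonicalWeldingLaw`** (skeleton v3's `canonicalWeldingLaw_of` with the
glue stub discharged by the tree theorem `weldingMarginalsOfLimit`; both statements inlined). If
every chord-supported subsequential weak limit `P` of the critical SAW laws in
`(Q.chord 0 2; a_δ, b_δ)` admits chord-supported probability measures `Pₙ → P` (weakly) whose
canonical-welding marginals converge weakly to those of chordal SLE_{8/3} (`hA`), then the
canonical-welding marginals of `P` itself ARE those of SLE_{8/3}: along `Pₙ` the image laws of the
welding vector converge both to the image law under `P` (`weldingMarginalsOfLimit`) and to the image
law under `ℙ ∘ Γ⁻¹`; limits are unique and integrals of bounded continuous functions determine a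
finite Borel measure on `ℝᵏ` (`ext_of_forall_integral_eq_of_IsFiniteMeasure`). [folklore] -/
theorem canonicalWeldingLaw_of_approxWeldingLaw :
    (∀ (Q : ConformalRectangle) (a b : ℝ → Site 2),
      SAW.IsEndpointApprox (Q.chord 0 2 (by decide)) a b →
      ∀ (P : Measure (CurveClass ℂ)), IsProbabilityMeasure P →
      ∀ (δs : ℕ → ℝ), (∀ n, 0 < δs n) → Tendsto δs atTop (𝓝 0) →
      (∀ f : BoundedContinuousFunction (CurveClass ℂ) ℝ,
        Tendsto (fun n => ∫ γ, f γ.curve ∂(SAW.law Q.carrier (δs n) (a (δs n)) (b (δs n))))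
          atTop (𝓝 (∫ γ, f γ ∂P))) →
      (∀ᵐ γ ∂P, (Q.chord 0 2 (by decide)).IsSimpleChord γ) →
      ∃ Ps : ℕ → Measure (CurveClass ℂ),
        (∀ n, IsProbabilityMeasure (Ps n)) ∧
        (∀ n, ∀ᵐ γ ∂(Ps n), (Q.chord 0 2 (by decide)).IsSimpleChord γ) ∧
        (∀ f : BoundedContinuousFunction (CurveClass ℂ) ℝ,
          Tendsto (fun n => ∫ γ, f γ ∂(Ps n)) atTop (𝓝 (∫ γ, f γ ∂P))) ∧
        ∀ Γ : (NNReal → ℝ) → CurveClass ℂ,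
          IsSLECurve ((8 : NNReal) / 3) (Q.chord 0 2 (by decide)) Γ →
          ∀ (k : ℕ) (x : Fin k → ℝ), (∀ i, 0 < x i) →
          ∀ g : BoundedContinuousFunction (Fin k → ℝ) ℝ,
            Tendsto (fun n => ∫ γ, g (fun i => conformalWelding Q γ (x i)) ∂(Ps n)) atTop
              (𝓝 (∫ γ, g (fun i => conformalWelding Q γ (x i)) ∂(preWienerMeasure.map Γ)))) →
    ∀ (Q : ConformalRectangle) (a b : ℝ → Site 2),
      SAW.IsEndpointApprox (Q.chord 0 2 (by decide)) a b →
      ∀ (P : Measure (CurveClass ℂ)), IsProbabilityMeasure P →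
      ∀ (δs : ℕ → ℝ), (∀ n, 0 < δs n) → Tendsto δs atTop (𝓝 0) →
      (∀ f : BoundedContinuousFunction (CurveClass ℂ) ℝ,
        Tendsto (fun n => ∫ γ, f γ.curve ∂(SAW.law Q.carrier (δs n) (a (δs n)) (b (δs n))))
          atTop (𝓝 (∫ γ, f γ ∂P))) →
      (∀ᵐ γ ∂P, (Q.chord 0 2 (by decide)).IsSimpleChord γ) →
      ∀ Γ : (NNReal → ℝ) → CurveClass ℂ, IsSLECurve ((8 : NNReal) / 3) (Q.chord 0 2 (by decide)) Γ →
      ∀ (k : ℕ) (x : Fin k → ℝ), (∀ i, 0 < x i) →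
        P.map (fun γ i => conformalWelding Q γ (x i)) =
          (preWienerMeasure.map Γ).map (fun γ i => conformalWelding Q γ (x i)) := by
  intro hA Q a b hab P hP δs hpos hδ hlim hPch Γ hΓ k x hx
  obtain ⟨Ps, hPsprob, hPsch, hPslim, hPsweld⟩ := hA Q a b hab P hP δs hpos hδ hlim hPch
  have hVm := measurable_weldingVector Q x
  haveI : IsProbabilityMeasure preWienerMeasure :=
    Literature.Probability.RandomPlanarGeometry.isProbabilityMeasure_preWienerMeasure'
  haveI : IsProbabilityMeasure (preWienerMeasure.map Γ) := Measure.isProbabilityMeasure_map hΓ.1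
  refine ext_of_forall_integral_eq_of_IsFiniteMeasure fun g => ?_
  rw [integral_map hVm.aemeasurable g.continuous.aestronglyMeasurable,
    integral_map hVm.aemeasurable g.continuous.aestronglyMeasurable]
  exact tendsto_nhds_unique (weldingMarginalsOfLimit Q Ps P hPsprob hP hPsch hPch hPslim k x g)
    (hPsweld Γ hΓ k x hx g)

/-! ### The crux ⇒ stub 2a (constant approximants) -/

/-- **`WeldingLawOfLimit ⇒ ApproxWeldingLaw`.** Under the crux, stub 2a holds with the constant
approximants `Pₙ := P`: they are chord-supported by hypothesis, converge to `P` trivially, and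
their canonical-welding marginals are constant and equal to those of SLE_{8/3} by (W) for the
canonical functional (`map_conformalWelding_eq_of_weldingLawOfLimit`, read on bounded continuous
functions through `integral_map`). With `canonicalWeldingLaw_of_approxWeldingLaw` and the tree's
reductions: (2a) ∧ stmt-4982 ⟺ (W) (⟺ stmt-0783). [folklore] -/
theorem approxWeldingLaw_of_weldingLawOfLimit :
    SAWWeldingIdentification.WeldingLawOfLimit → ∀ (Q : ConformalRectangle) (a b : ℝ → Site 2),
      SAW.IsEndpointApprox (Q.chord 0 2 (by decide)) a b →
      ∀ (P : Measure (CurveClass ℂ)), IsProbabilityMeasure P →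
      ∀ (δs : ℕ → ℝ), (∀ n, 0 < δs n) → Tendsto δs atTop (𝓝 0) →
      (∀ f : BoundedContinuousFunction (CurveClass ℂ) ℝ,
        Tendsto (fun n => ∫ γ, f γ.curve ∂(SAW.law Q.carrier (δs n) (a (δs n)) (b (δs n))))
          atTop (𝓝 (∫ γ, f γ ∂P))) →
      (∀ᵐ γ ∂P, (Q.chord 0 2 (by decide)).IsSimpleChord γ) →
      ∃ Ps : ℕ → Measure (CurveClass ℂ),
        (∀ n, IsProbabilityMeasure (Ps n)) ∧
        (∀ n, ∀ᵐ γ ∂(Ps n), (Q.chord 0 2 (by decide)).IsSimpleChord γ) ∧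
        (∀ f : BoundedContinuousFunction (CurveClass ℂ) ℝ,
          Tendsto (fun n => ∫ γ, f γ ∂(Ps n)) atTop (𝓝 (∫ γ, f γ ∂P))) ∧
        ∀ Γ : (NNReal → ℝ) → CurveClass ℂ,
          IsSLECurve ((8 : NNReal) / 3) (Q.chord 0 2 (by decide)) Γ →
          ∀ (k : ℕ) (x : Fin k → ℝ), (∀ i, 0 < x i) →
          ∀ g : BoundedContinuousFunction (Fin k → ℝ) ℝ,
            Tendsto (fun n => ∫ γ, g (fun i => conformalWelding Q γ (x i)) ∂(Ps n)) atTop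
              (𝓝 (∫ γ, g (fun i => conformalWelding Q γ (x i)) ∂(preWienerMeasure.map Γ))) := by
  intro h Q a b hab P hP δs hpos hδ hlim hPch
  refine ⟨fun _ => P, fun _ => hP, fun _ => hPch, fun f => tendsto_const_nhds, ?_⟩
  intro Γ hΓ k x hx g
  have hVm := measurable_weldingVector Q x
  have hmap := map_conformalWelding_eq_of_weldingLawOfLimit h Q a b hab P hP δs hpos hδ hlim Γ hΓ
    k x hx
  have e1 := integral_map (μ := P) hVm.aemeasurable g.continuous.aestronglyMeasurable
  have e2 := integral_map (μ := preWienerMeasure.map Γ) hVm.aemeasurable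
    g.continuous.aestronglyMeasurable
  rw [hmap] at e1
  have heq : ∫ γ, g (fun i => conformalWelding Q γ (x i)) ∂P =
      ∫ γ, g (fun i => conformalWelding Q γ (x i)) ∂(preWienerMeasure.map Γ) := e1.symm.trans e2
  have hfun : (fun n : ℕ => ∫ γ, g (fun i => conformalWelding Q γ (x i)) ∂((fun _ : ℕ => P) n)) =
      fun _ => ∫ γ, g (fun i => conformalWelding Q γ (x i)) ∂(preWienerMeasure.map Γ) :=
    funext fun _ => heq
  rw [hfun]
  exact tendsto_const_nhds

/-! ### What remains of the line and of the route, at item level -/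

/-- **Skeleton v3 at item level: stmt-4982 ∧ `ApproxWeldingLaw` ⇒ (W).** The shared simplicity
crux `SimpleSubseqLimits` (stub 1) gives chord support of every subsequential limit
(`ae_isSimpleChord_of_simpleSubseqLimits`), stub 2a gives the canonical welding law
(`canonicalWeldingLaw_of_approxWeldingLaw`), and chord support + canonical welding law give the
crux for every pinned functional (`weldingLawOfLimit_of_chordSupport_of_canonical`). [folklore] -/
theorem weldingLawOfLimit_of_simpleSubseqLimits_of_approxWeldingLaw :
    SAWLoopFugacityFlow.SimpleSubseqLimits →
    (∀ (Q : ConformalRectangle) (a b : ℝ → Site 2),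
      SAW.IsEndpointApprox (Q.chord 0 2 (by decide)) a b →
      ∀ (P : Measure (CurveClass ℂ)), IsProbabilityMeasure P →
      ∀ (δs : ℕ → ℝ), (∀ n, 0 < δs n) → Tendsto δs atTop (𝓝 0) →
      (∀ f : BoundedContinuousFunction (CurveClass ℂ) ℝ,
        Tendsto (fun n => ∫ γ, f γ.curve ∂(SAW.law Q.carrier (δs n) (a (δs n)) (b (δs n))))
          atTop (𝓝 (∫ γ, f γ ∂P))) →
      (∀ᵐ γ ∂P, (Q.chord 0 2 (by decide)).IsSimpleChord γ) →
      ∃ Ps : ℕ → Measure (CurveClass ℂ),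
        (∀ n, IsProbabilityMeasure (Ps n)) ∧
        (∀ n, ∀ᵐ γ ∂(Ps n), (Q.chord 0 2 (by decide)).IsSimpleChord γ) ∧
        (∀ f : BoundedContinuousFunction (CurveClass ℂ) ℝ,
          Tendsto (fun n => ∫ γ, f γ ∂(Ps n)) atTop (𝓝 (∫ γ, f γ ∂P))) ∧
        ∀ Γ : (NNReal → ℝ) → CurveClass ℂ,
          IsSLECurve ((8 : NNReal) / 3) (Q.chord 0 2 (by decide)) Γ →
          ∀ (k : ℕ) (x : Fin k → ℝ), (∀ i, 0 < x i) →
          ∀ g : BoundedContinuousFunction (Fin k → ℝ) ℝ,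
            Tendsto (fun n => ∫ γ, g (fun i => conformalWelding Q γ (x i)) ∂(Ps n)) atTop
              (𝓝 (∫ γ, g (fun i => conformalWelding Q γ (x i)) ∂(preWienerMeasure.map Γ)))) →
    SAWWeldingIdentification.WeldingLawOfLimit := fun h1 hA =>
  weldingLawOfLimit_of_chordSupport_of_canonical (ae_isSimpleChord_of_simpleSubseqLimits h1)
    (canonicalWeldingLaw_of_approxWeldingLaw hA)

/-- **stmt-4982 ∧ `ApproxWeldingLaw` ⇒ stmt-0783** (`SubseqIdentification`, the shared
identification crux): compose with `RemovableLimit.subseqIdentification_of_weldingLawOfLimit'`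
((W) alone identifies every subsequential limit, one-sided rigidity + disintegration). [folklore] -/
theorem subseqIdentification_of_simpleSubseqLimits_of_approxWeldingLaw
    (h1 : SAWLoopFugacityFlow.SimpleSubseqLimits)
    (hA : ∀ (Q : ConformalRectangle) (a b : ℝ → Site 2),
      SAW.IsEndpointApprox (Q.chord 0 2 (by decide)) a b →
      ∀ (P : Measure (CurveClass ℂ)), IsProbabilityMeasure P →
      ∀ (δs : ℕ → ℝ), (∀ n, 0 < δs n) → Tendsto δs atTop (𝓝 0) →
      (∀ f : BoundedContinuousFunction (CurveClass ℂ) ℝ,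
        Tendsto (fun n => ∫ γ, f γ.curve ∂(SAW.law Q.carrier (δs n) (a (δs n)) (b (δs n))))
          atTop (𝓝 (∫ γ, f γ ∂P))) →
      (∀ᵐ γ ∂P, (Q.chord 0 2 (by decide)).IsSimpleChord γ) →
      ∃ Ps : ℕ → Measure (CurveClass ℂ),
        (∀ n, IsProbabilityMeasure (Ps n)) ∧
        (∀ n, ∀ᵐ γ ∂(Ps n), (Q.chord 0 2 (by decide)).IsSimpleChord γ) ∧
        (∀ f : BoundedContinuousFunction (CurveClass ℂ) ℝ,
          Tendsto (fun n => ∫ γ, f γ ∂(Ps n)) atTop (𝓝 (∫ γ, f γ ∂P))) ∧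
        ∀ Γ : (NNReal → ℝ) → CurveClass ℂ,
          IsSLECurve ((8 : NNReal) / 3) (Q.chord 0 2 (by decide)) Γ →
          ∀ (k : ℕ) (x : Fin k → ℝ), (∀ i, 0 < x i) →
          ∀ g : BoundedContinuousFunction (Fin k → ℝ) ℝ,
            Tendsto (fun n => ∫ γ, g (fun i => conformalWelding Q γ (x i)) ∂(Ps n)) atTop
              (𝓝 (∫ γ, g (fun i => conformalWelding Q γ (x i)) ∂(preWienerMeasure.map Γ)))) :
    SAWLoopFugacityFlow.SubseqIdentification :=
  RemovableLimit.subseqIdentification_of_weldingLawOfLimit'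
    (weldingLawOfLimit_of_simpleSubseqLimits_of_approxWeldingLaw h1 hA)

/-- **stmt-4982 ∧ `ApproxWeldingLaw` ∧ `EventualTight` ⇒ `SAWScalingLimit`**: what remains of route
`SAWWeldingIdentification` after skeleton v3 — the shared simplicity crux, the welding law along
chord-supported approximants, and eventual tightness (stmt-1372); every other item and the glue are
proved tree theorems (`RemovableLimit.sawScalingLimit_of_weldingLawOfLimit_of_eventualTight`).
[folklore] -/
theorem sawScalingLimit_of_simpleSubseqLimits_of_approxWeldingLaw_of_eventualTight
    (h1 : SAWLoopFugacityFlow.SimpleSubseqLimits)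
    (hA : ∀ (Q : ConformalRectangle) (a b : ℝ → Site 2),
      SAW.IsEndpointApprox (Q.chord 0 2 (by decide)) a b →
      ∀ (P : Measure (CurveClass ℂ)), IsProbabilityMeasure P →
      ∀ (δs : ℕ → ℝ), (∀ n, 0 < δs n) → Tendsto δs atTop (𝓝 0) →
      (∀ f : BoundedContinuousFunction (CurveClass ℂ) ℝ,
        Tendsto (fun n => ∫ γ, f γ.curve ∂(SAW.law Q.carrier (δs n) (a (δs n)) (b (δs n))))
          atTop (𝓝 (∫ γ, f γ ∂P))) →
      (∀ᵐ γ ∂P, (Q.chord 0 2 (by decide)).IsSimpleChord γ) →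
      ∃ Ps : ℕ → Measure (CurveClass ℂ),
        (∀ n, IsProbabilityMeasure (Ps n)) ∧
        (∀ n, ∀ᵐ γ ∂(Ps n), (Q.chord 0 2 (by decide)).IsSimpleChord γ) ∧
        (∀ f : BoundedContinuousFunction (CurveClass ℂ) ℝ,
          Tendsto (fun n => ∫ γ, f γ ∂(Ps n)) atTop (𝓝 (∫ γ, f γ ∂P))) ∧
        ∀ Γ : (NNReal → ℝ) → CurveClass ℂ,
          IsSLECurve ((8 : NNReal) / 3) (Q.chord 0 2 (by decide)) Γ →
          ∀ (k : ℕ) (x : Fin k → ℝ), (∀ i, 0 < x i) →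
          ∀ g : BoundedContinuousFunction (Fin k → ℝ) ℝ,
            Tendsto (fun n => ∫ γ, g (fun i => conformalWelding Q γ (x i)) ∂(Ps n)) atTop
              (𝓝 (∫ γ, g (fun i => conformalWelding Q γ (x i)) ∂(preWienerMeasure.map Γ))))
    (hT : SAWWeldingIdentification.EventualTight) : _root_.SAWScalingLimit :=
  RemovableLimit.sawScalingLimit_of_weldingLawOfLimit_of_eventualTight
    (weldingLawOfLimit_of_simpleSubseqLimits_of_approxWeldingLaw h1 hA) hT

end Summit.CriticalPhenomena.SAWScalingLimit.Theorems.WeldingLawOfLimit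

end
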